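import Summits.ResolutionOfSingularities.ResolutionOfSingularities.Theorems.WeightedInvariantIota3IsoSuccOffExceptional
import Summits.ResolutionOfSingularities.ResolutionOfSingularities.Theorems.WeightedInvariantIota3EpsStratumRing
import HarnessLib

/-!
# Point moves VIII: the EQUIMULTIPLE LOCUS at an order-stationary successor — the closed point plus the primes off `V(t⁻¹)` over the start's
# equimultiple locus (door `HypersurfaceCentreConstruction`, stmt-ResolutionOfSingularities-19897; stub `stub_keyRungGrHomLE_three`, residual (TIE-ON)
# of …KeyRungThreeOfDropPointSplit)

Topic: `Summits/ResolutionOfSingularities/ResolutionOfSingularities/Theorems`.  DEF-FREE.  Helper `--supports stmt-ResolutionOfSingularities-19897`.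

For the TIE regime ON the strict transform ((TIE-ON) of `keyRungGrHomLE_three_of_tieDescent_pointSplit`) the letter `ε` at the successor reads the
equimultiple locus `Σ(B_𝔫, g/1)`.  When the order drops at every prime `t⁻¹ ∈ 𝔮 < 𝔫` (the exceptional half, …KeyRungThreeOfDropPointEps at every
`ε ≠ 1` point start) and the transform is order-stationary at `𝔫`, this locus is EXPLICIT:

* **`LocalGameEFTPointMove.mem_topStratum_iotaOrd_transform_iff`** — `B = S[t⁻¹, 𝒥ₙtⁿ]` (any point-centre presentation), `f = (t⁻¹)ᵃ g`,
  `ord_S f = ν = ord_{B_𝔫}(g/1)`, order `< ν` at every `t⁻¹ ∈ 𝔮 < 𝔫`.  Then a prime `Q` of `B_𝔫` lies in `Σ(B_𝔫, g/1)` iff `Q` is the closed point,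
  or `t⁻¹ ∉ Q` and `Q ∩ S ∈ Σ(S, f)`.

So at a TIE start (`Σ(S, f) = V(P₀)` a regular curve) the equimultiple locus of an order-stationary successor is the closed point together with the
primes of the strict transform of `V(P₀)` through it — the input of the (TIE-ON) `ε`-bookkeeping (regularity of that strict transform) for the next hand.

[OURS · L1 W4.3 · audit glue; AI work, weaker than expert review; nothing here is a statement of the manuscript under review (Hironaka 2017,
[claim: Hironaka2017, status: under-review]).]

## References

* J. Włodarczyk, *Functorial resolution by torus actions*, arXiv:2203.03090, Def. 2.3.5, §3.3. [Wlodarczyk2022]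
-/

noncomputable section

open IsLocalRing Literature.AlgebraicGeometry.Resolution
open Summit.ResolutionOfSingularities.ResolutionOfSingularities.Cruxes.HypersurfaceCentreConstruction.LocalEngine
open Summit.ResolutionOfSingularities.ResolutionOfSingularities.Cruxes.HypersurfaceCentreConstruction.LocalEngine.Iota3
  (iotaOrd_localization_atPrime_algebraMap_eq comap_le_of_isLocalization_atPrime iotaOrd_atPrime_congr)

set_option linter.dupNamespace false -- mandated namespace of this single-conjunct summit

namespace Summit.ResolutionOfSingularities.ResolutionOfSingularities.Theorems

namespace LocalGameEFTPointMove

variable {S : Type} [CommRing S] {d : ℕ} (u : Fin d → S) (w : Fin d → ℕ)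

/-- A prime of `B_𝔫` whose contraction to `B` is `𝔫` is the maximal ideal. [folklore] -/
theorem eq_maximalIdeal_of_comap_eq {B : Type} [CommRing B] (𝔫 : Ideal B) [𝔫.IsPrime] (Q : Ideal (Localization.AtPrime 𝔫)) [Q.IsPrime]
    (h : Q.comap (algebraMap B (Localization.AtPrime 𝔫)) = 𝔫) : Q = maximalIdeal (Localization.AtPrime 𝔫) := by
  have h1 := IsLocalization.map_under 𝔫.primeCompl (Localization.AtPrime 𝔫) Q
  change (Q.comap (algebraMap B (Localization.AtPrime 𝔫))).map (algebraMap B (Localization.AtPrime 𝔫)) = Q at h1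
  rw [h, Localization.AtPrime.map_eq_maximalIdeal] at h1
  exact h1.symm

set_option maxHeartbeats 400000 in
/-- **THE EQUIMULTIPLE LOCUS AT AN ORDER-STATIONARY SUCCESSOR.**  `f = (t⁻¹)ᵃ g` in `B = S[t⁻¹, 𝒥ₙtⁿ]`, `ord_S f = ν = ord_{B_𝔫}(g/1)`, and the order
of `g` is `< ν` at every prime `t⁻¹ ∈ 𝔮 < 𝔫`.  Then a prime `Q` of `B_𝔫` is in the equimultiple locus of `g/1` iff it is the closed point, or it
misses `t⁻¹` and contracts into the equimultiple locus of `(S, f)`. [OURS · L1 W4.3] [cite: Wlodarczyk2022, Def. 2.3.5] -/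
theorem mem_topStratum_iotaOrd_transform_iff (𝔫 : Ideal (extReesAlgebra (weightedMonomialIdeal u w))) [𝔫.IsPrime]
    {f : S} {a : ℕ} {g : extReesAlgebra (weightedMonomialIdeal u w)}
    (hfg : algebraMap S (extReesAlgebra (weightedMonomialIdeal u w)) f = extReesAlgebra.tInv (weightedMonomialIdeal u w) ^ a * g)
    {ν : ℕ} (hνS : iotaOrd S f = ν)
    (hstat : iotaOrd (Localization.AtPrime 𝔫) (algebraMap _ (Localization.AtPrime 𝔫) g) = ν)
    (hbelowT : ∀ (𝔮 : Ideal (extReesAlgebra (weightedMonomialIdeal u w))) [𝔮.IsPrime],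
      extReesAlgebra.tInv (weightedMonomialIdeal u w) ∈ 𝔮 → 𝔮 < 𝔫 →
      iotaOrd (Localization.AtPrime 𝔮) (algebraMap _ (Localization.AtPrime 𝔮) g) < ν)
    (Q : PrimeSpectrum (Localization.AtPrime 𝔫)) :
    Q ∈ ContactCylinder.topStratum iotaOrd (Localization.AtPrime 𝔫) (algebraMap _ (Localization.AtPrime 𝔫) g) ↔
      Q.asIdeal = maximalIdeal (Localization.AtPrime 𝔫) ∨
        (algebraMap _ (Localization.AtPrime 𝔫) (extReesAlgebra.tInv (weightedMonomialIdeal u w)) ∉ Q.asIdeal ∧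
          (⟨(Q.asIdeal.comap (algebraMap (extReesAlgebra (weightedMonomialIdeal u w)) (Localization.AtPrime 𝔫))).comap
              (algebraMap S (extReesAlgebra (weightedMonomialIdeal u w))), Ideal.IsPrime.comap _⟩ : PrimeSpectrum S) ∈
            ContactCylinder.topStratum iotaOrd S f) := by
  set 𝔮 : Ideal (extReesAlgebra (weightedMonomialIdeal u w)) :=
    Q.asIdeal.comap (algebraMap (extReesAlgebra (weightedMonomialIdeal u w)) (Localization.AtPrime 𝔫)) with h𝔮def
  haveI : 𝔮.IsPrime := Ideal.IsPrime.comap _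
  have hle : 𝔮 ≤ 𝔫 := comap_le_of_isLocalization_atPrime 𝔫 (Localization.AtPrime 𝔫) Q.asIdeal
  -- the order at `Q` is the order at `𝔮`
  rw [ContactCylinder.mem_topStratum_iff, iotaOrd_localization_atPrime_algebraMap_eq 𝔫 (Localization.AtPrime 𝔫) g Q.asIdeal, hstat]
  have hTQ : algebraMap _ (Localization.AtPrime 𝔫) (extReesAlgebra.tInv (weightedMonomialIdeal u w)) ∈ Q.asIdeal ↔
      extReesAlgebra.tInv (weightedMonomialIdeal u w) ∈ 𝔮 := Iff.rfl
  by_cases heq : 𝔮 = 𝔫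
  · -- the closed point
    have hQ : Q.asIdeal = maximalIdeal (Localization.AtPrime 𝔫) := eq_maximalIdeal_of_comap_eq 𝔫 Q.asIdeal heq
    refine ⟨fun _ => Or.inl hQ, fun _ => ?_⟩
    rw [iotaOrd_atPrime_congr heq g, hstat]
  · have hlt : 𝔮 < 𝔫 := lt_of_le_of_ne hle heq
    have hQne : Q.asIdeal ≠ maximalIdeal (Localization.AtPrime 𝔫) := by
      intro hQ
      apply heq
      rw [h𝔮def, hQ]
      exact IsLocalization.AtPrime.under_maximalIdeal (Localization.AtPrime 𝔫) 𝔫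
    by_cases hT : extReesAlgebra.tInv (weightedMonomialIdeal u w) ∈ 𝔮
    · -- on the exceptional divisor the order drops
      have h := hbelowT 𝔮 hT hlt
      refine ⟨fun h' => absurd h' h.ne, fun h' => ?_⟩
      rcases h' with h' | ⟨h', -⟩
      · exact absurd h' hQne
      · exact absurd (hTQ.mpr hT) h'
    · -- off the exceptional divisor the order is the order downstairs
      rw [iotaOrd_transform_atPrime_eq_of_tInv_not_mem u w 𝔮 hT hfg]
      refine ⟨fun h' => Or.inr ⟨fun hTQ' => hT (hTQ.mp hTQ'), ?_⟩, fun h' => ?_⟩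
      · rw [ContactCylinder.mem_topStratum_iff, hνS]
        exact h'
      · rcases h' with h' | ⟨-, h'⟩
        · exact absurd h' hQne
        · rw [← hνS]
          exact (ContactCylinder.mem_topStratum_iff iotaOrd S f
            ⟨𝔮.comap (algebraMap S (extReesAlgebra (weightedMonomialIdeal u w))), inferInstance⟩).mp h'

end LocalGameEFTPointMove

end Summit.ResolutionOfSingularities.ResolutionOfSingularities.Theorems

end
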